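import Literature.Analysis.Complex.SeveralVariables
import Mathlib.Analysis.Complex.RemovableSingularity
import Mathlib.Analysis.Analytic.IsolatedZeros
import HarnessLib

/-!
# The Riemann extension theorem in several complex variables

Trunk support for the local theory of analytic sets (`Literature/Geometry/Kaehler/AnalyticSet*.lean`,
Chirka, *Complex Analytic Sets*, Ch. 1): holomorphic functions bounded near a *thin* set extend
across it. Everything is stated for `f : E → F` with `E` an arbitrary complex normed space and `F`
complete, in the `DifferentiableOn ℂ` language of `Literature/Analysis/Complex/SeveralVariables.lean`.

* `Literature.Analysis.Complex.SCV.differentiableAt_intervalIntegral_affine` — **integrals depending holomorphically on a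
  parameter** (Chirka A1.1, Lemma 1, in affine form): `x ↦ ∫ θ in a..b, c θ • H (L x + p θ)` is
  holomorphic when `H` is (differentiation under the integral sign, `H` being `C¹` by
  `Literature.Analysis.Complex.SCV.contDiffOn_one`);
* `Literature.Analysis.Complex.SCV.eqOn_zero_of_preconnected_of_eventuallyEq_zero` — the **identity theorem** on connected
  open sets (from the identity principle on balls of `SeveralVariables.lean`);
* `Literature.Analysis.Complex.SCV.exists_differentiableOn_eqOn_diff_finset` — one variable: removable singularities along a
  finite set (Mathlib's `Complex.differentiableOn_update_limUnder_of_bddAbove`, iterated);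
  `Literature.Analysis.Complex.SCV.finite_zeros_of_isCompact` — finiteness of zeros on compact sets;
* `Literature.Analysis.Complex.SCV.exists_nhds_differentiableOn_eqOn_of_thin` (local form) and
  `Literature.Analysis.Complex.SCV.exists_differentiableOn_eqOn_of_thin` — the **Riemann extension theorem**: if `A` is thin
  in `U` (near each of its points contained in the zero set of a holomorphic function not vanishing
  identically there) and `f` is holomorphic on `U ∖ A` and locally bounded near `A`, then `f`
  extends holomorphically to `U`; `Literature.Analysis.Complex.SCV.subset_closure_diff_of_thin` (thin sets are nowhere
  dense) and `Literature.Analysis.Complex.SCV.eqOn_of_eqOn_diff_of_thin` (uniqueness of the extension).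

## Proof of the extension theorem

As in Chirka A1.4 (proof of the Theorem, case `n > 1`, there for closed sets of Hausdorff measure
`H_{2n-1}(E) = 0`): near `a ∈ A` pick a direction `v` with `φ (a + v) ≠ 0` (`φ` a local equation
of a hypersurface containing `A`) and a radius `r` with `φ (a + t v) ≠ 0` for `|t| = r` (isolated
zeros of the slice); by compactness the same holds for the circles `{z + t v : |t| = r}`, `z` near
`a`. Define `g z = (2πi)⁻¹ ∮_{|t|=r} f (z + t v) t⁻¹ dt`: it is holomorphic in `z` (Lemma 1), and for
`z ∉ A` the slice `t ↦ f (z + t v)` is holomorphic on the disc `|t| ≤ r` off the finite set where the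
disc meets `A`, and bounded, so it extends across that set and Cauchy's formula gives `g z = f z`.
The local extensions patch to a global one because `U ∖ A` is dense in `U`.

## References

* E. M. Chirka, *Complex Analytic Sets*, Kluwer (1989), Appendix A1.1 (Lemma 1, Lemma 2,
  uniqueness theorem), A1.4 (removable singularities of bounded functions) [Chirka1989].
-/

open Complex Metric Set Filter Function
open scoped Topology Real Interval

namespace Literature.Analysis.Complex
namespace SCV

variable {E : Type*} [NormedAddCommGroup E] [NormedSpace ℂ E]
  {E' : Type*} [NormedAddCommGroup E'] [NormedSpace ℂ E']
  {F : Type*} [NormedAddCommGroup F] [NormedSpace ℂ F]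

/-! ### Holomorphic dependence of integrals on parameters (Chirka A1.1, Lemma 1) -/

section ParamIntegral

variable [CompleteSpace F]

/-- **Integrals depending holomorphically on a parameter** (Chirka, A1.1 Lemma 1, in the affine
form used in this file). Let `H` be complex-differentiable on an open set `U'` of a complex normed
space `E'` (values in a complete space), `L : E →L[ℂ] E'` continuous linear, `p : ℝ → E'` and
`c : ℝ → ℂ` continuous, and suppose the compact arc `{L x₀ + p θ | θ ∈ [a, b]}` lies in `U'`.
Then `x ↦ ∫ θ in a..b, c θ • H (L x + p θ)` is complex-differentiable at `x₀`
(differentiation under the integral sign; the derivative of `H` is continuous, `H` being `C¹`).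
[Chirka, *Complex Analytic Sets*, A1.1 Lemma 1] [folklore] -/
theorem differentiableAt_intervalIntegral_affine {H : E' → F} {U' : Set E'}
    (hH : DifferentiableOn ℂ H U') (hU' : IsOpen U') (L : E →L[ℂ] E') {p : ℝ → E'}
    (hp : Continuous p) {c : ℝ → ℂ} (hc : Continuous c) {a b : ℝ} {x₀ : E}
    (hmem : ∀ θ ∈ uIcc a b, L x₀ + p θ ∈ U') :
    DifferentiableAt ℂ (fun x => ∫ θ in a..b, c θ • H (L x + p θ)) x₀ := by
  -- the affine substitution `(x, θ) ↦ L x + p θ`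
  have hΨc : Continuous fun q : E × ℝ => L q.1 + p q.2 :=
    (L.continuous.comp continuous_fst).add (hp.comp continuous_snd)
  have hcont : ContinuousOn (fun q : E × ℝ => ‖fderiv ℂ H (L q.1 + p q.2)‖)
      ((fun q : E × ℝ => L q.1 + p q.2) ⁻¹' U') :=
    ((continuousOn_fderiv hH hU').comp hΨc.continuousOn fun q hq => hq).norm
  -- a uniform bound `M` for `‖fderiv ℂ H‖` along the arc, and a tube around the arc inside `U'`
  have hfd : ContinuousOn (fun θ => fderiv ℂ H (L x₀ + p θ)) (uIcc a b) :=
    (continuousOn_fderiv hH hU').comp (continuous_const.add hp).continuousOn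
      fun θ hθ => hmem θ hθ
  obtain ⟨M, hM⟩ : ∃ M : ℝ, ∀ θ ∈ uIcc a b, ‖fderiv ℂ H (L x₀ + p θ)‖ < M := by
    have hK : IsCompact ((fun θ => ‖fderiv ℂ H (L x₀ + p θ)‖) '' uIcc a b) :=
      isCompact_uIcc.image_of_continuousOn hfd.norm
    obtain ⟨M, hM⟩ := hK.isBounded.bddAbove
    exact ⟨M + 1, fun θ hθ => lt_of_le_of_lt (hM (mem_image_of_mem _ hθ)) (lt_add_one M)⟩
  set N : Set (E × ℝ) :=
    {q | L q.1 + p q.2 ∈ U' ∧ ‖fderiv ℂ H (L q.1 + p q.2)‖ < M} with hN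
  have hNo : IsOpen N := by
    have h1 : IsOpen ((fun q : E × ℝ => L q.1 + p q.2) ⁻¹' U') := hU'.preimage hΨc
    have := hcont.isOpen_inter_preimage h1 (isOpen_Iio (a := M))
    simpa only [hN, preimage, mem_Iio, setOf_and] using this
  have hsub : ({x₀} : Set E) ×ˢ uIcc a b ⊆ N := by
    rintro ⟨x, θ⟩ ⟨hx, hθ⟩
    rw [mem_singleton_iff] at hx
    subst hx
    exact ⟨hmem θ hθ, hM θ hθ⟩
  obtain ⟨V, W, hVo, hWo, hxV, hW, hVW⟩ :=
    generalized_tube_lemma isCompact_singleton isCompact_uIcc hNo hsub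
  have hx₀V : x₀ ∈ V := hxV (mem_singleton x₀)
  have hVW' : ∀ x ∈ V, ∀ θ ∈ uIcc a b, L x + p θ ∈ U' ∧ ‖fderiv ℂ H (L x + p θ)‖ < M :=
    fun x hx θ hθ => hVW (mk_mem_prod hx (hW hθ))
  -- differentiation under the integral sign
  set G : E → ℝ → F := fun x θ => c θ • H (L x + p θ) with hG
  set G' : E → ℝ → (E →L[ℂ] F) := fun x θ => c θ • (fderiv ℂ H (L x + p θ)).comp L with hG'
  have hGc : ∀ x ∈ V, ContinuousOn (G x) (uIcc a b) := by
    intro x hx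
    refine hc.continuousOn.smul (hH.continuousOn.comp ?_ fun θ hθ => (hVW' x hx θ hθ).1)
    exact (continuous_const.add hp).continuousOn
  have hG'c : ContinuousOn (G' x₀) (uIcc a b) :=
    hc.continuousOn.smul
      (((ContinuousLinearMap.compL ℂ E E' F).flip L).continuous.comp_continuousOn hfd)
  have hderiv : HasFDerivAt (fun x => ∫ θ in a..b, G x θ) (∫ θ in a..b, G' x₀ θ) x₀ := by
    refine intervalIntegral.hasFDerivAt_integral_of_dominated_of_fderiv_le (𝕜 := ℂ)
      (bound := fun θ => ‖c θ‖ * (M * ‖L‖)) (hVo.mem_nhds hx₀V) ?_ ?_ ?_ ?_ ?_ ?_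
    · filter_upwards [hVo.mem_nhds hx₀V] with x hx
      exact ((hGc x hx).mono uIoc_subset_uIcc).aestronglyMeasurable measurableSet_uIoc
    · exact (hGc x₀ hx₀V).intervalIntegrable
    · exact (hG'c.mono uIoc_subset_uIcc).aestronglyMeasurable measurableSet_uIoc
    · refine Eventually.of_forall fun θ hθ x hx => ?_
      have hθ' : θ ∈ uIcc a b := uIoc_subset_uIcc hθ
      calc ‖G' x θ‖ ≤ ‖c θ‖ * (‖fderiv ℂ H (L x + p θ)‖ * ‖L‖) := by
            rw [hG', norm_smul]
            gcongr
            exact ContinuousLinearMap.opNorm_comp_le _ _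
        _ ≤ ‖c θ‖ * (M * ‖L‖) := by
            gcongr
            exact (hVW' x hx θ hθ').2.le
    · exact (hc.norm.mul continuous_const).intervalIntegrable _ _
    · refine Eventually.of_forall fun θ hθ x hx => ?_
      have hθ' : θ ∈ uIcc a b := uIoc_subset_uIcc hθ
      have hd : DifferentiableAt ℂ H (L x + p θ) :=
        hH.differentiableAt (hU'.mem_nhds (hVW' x hx θ hθ').1)
      have h1 : HasFDerivAt (fun x : E => H (L x + p θ)) ((fderiv ℂ H (L x + p θ)).comp L) x :=
        hd.hasFDerivAt.comp x (L.hasFDerivAt.add_const (p θ))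
      exact h1.const_smul (c θ)
  exact hderiv.differentiableAt

/-- `DifferentiableOn` form of `differentiableAt_intervalIntegral_affine`. [folklore] -/
theorem differentiableOn_intervalIntegral_affine {H : E' → F} {U' : Set E'}
    (hH : DifferentiableOn ℂ H U') (hU' : IsOpen U') (L : E →L[ℂ] E') {p : ℝ → E'}
    (hp : Continuous p) {c : ℝ → ℂ} (hc : Continuous c) {a b : ℝ} {V : Set E}
    (hmem : ∀ x ∈ V, ∀ θ ∈ uIcc a b, L x + p θ ∈ U') :
    DifferentiableOn ℂ (fun x => ∫ θ in a..b, c θ • H (L x + p θ)) V := fun x hx =>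
  (differentiableAt_intervalIntegral_affine hH hU' L hp hc (hmem x hx)).differentiableWithinAt

end ParamIntegral

/-! ### Identity theorem on connected open sets -/

/-- **Identity theorem** for holomorphic functions of several variables on a connected open set:
if `f` is complex-differentiable on a preconnected open `U` and vanishes near one point of `U`,
it vanishes on `U` (the set of points near which `f ≡ 0` is open and, by the identity principle
on balls `eqOn_zero_ball_of_iterate_fderiv_apply_eq_zero`, closed in `U`).
[Chirka, *Complex Analytic Sets*, A1.1 (uniqueness theorem)] [folklore] -/
theorem eqOn_zero_of_preconnected_of_eventuallyEq_zero [CompleteSpace F] {f : E → F} {U : Set E}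
    (hf : DifferentiableOn ℂ f U) (hU : IsOpen U) (hU' : IsPreconnected U) {x₀ : E}
    (hx₀ : x₀ ∈ U) (h₀ : f =ᶠ[𝓝 x₀] 0) : EqOn f 0 U := by
  -- the set of points near which `f` vanishes identically is open ...
  have hZo : IsOpen {x : E | f =ᶠ[𝓝 x] 0} := by
    refine isOpen_iff_mem_nhds.2 fun x hx => ?_
    exact (eventually_eventually_nhds.2 hx).mono fun y hy => hy
  -- ... and closed inside `U`: if `x ∈ U` is a limit of such points, then `x` is such a point
  have hZc : ∀ x ∈ U, x ∈ closure {x : E | f =ᶠ[𝓝 x] 0} → f =ᶠ[𝓝 x] 0 := by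
    intro x hx hxZ
    obtain ⟨ρ, hρ, hρU⟩ := Metric.isOpen_iff.1 hU x hx
    obtain ⟨z, hzZ, hzx⟩ := Metric.mem_closure_iff.1 hxZ (ρ / 2) (half_pos hρ)
    rw [mem_setOf_eq] at hzZ
    have hsub : ball z (ρ / 2) ⊆ U := by
      refine Subset.trans (fun y hy => ?_) hρU
      rw [mem_ball] at hy ⊢
      linarith [dist_triangle y z x, dist_comm x z]
    have hder : ∀ (v : E) (k : ℕ), ((fderiv ℂ · · v)^[k] f) z = 0 := by
      intro v k
      have hk : ((fderiv ℂ · · v)^[k] f) =ᶠ[𝓝 z] 0 := by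
        induction k with
        | zero => simpa using hzZ
        | succ k ih =>
          rw [Function.iterate_succ_apply']
          have h1 : (fun y => fderiv ℂ ((fderiv ℂ · · v)^[k] f) y) =ᶠ[𝓝 z]
              fun _ => (0 : E →L[ℂ] F) := by
            filter_upwards [eventually_eventually_nhds.2 ih] with y hy
            rw [Filter.EventuallyEq.fderiv_eq hy]
            simp
          filter_upwards [h1] with y hy
          simp [hy]
      exact hk.self_of_nhds
    have hball := eqOn_zero_ball_of_iterate_fderiv_apply_eq_zero hf hU hsub hder
    exact eventuallyEq_of_mem (isOpen_ball.mem_nhds (mem_ball.2 hzx)) hball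
  -- connectedness of `U`
  have key : ∀ y ∈ U, f =ᶠ[𝓝 y] 0 := by
    by_contra hcon
    push Not at hcon
    obtain ⟨y, hyU, hyZ⟩ := hcon
    have hcover : U ⊆ {x : E | f =ᶠ[𝓝 x] 0} ∪ (closure {x : E | f =ᶠ[𝓝 x] 0})ᶜ := by
      intro u hu
      by_cases huZ : f =ᶠ[𝓝 u] 0
      · exact Or.inl huZ
      · exact Or.inr fun h => huZ (hZc u hu h)
    obtain ⟨u, -, huZ, huc⟩ := hU' _ _ hZo isClosed_closure.isOpen_compl hcover
      ⟨x₀, hx₀, h₀⟩ ⟨y, hyU, fun hy => hyZ (hZc y hyU hy)⟩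
    exact huc (subset_closure huZ)
  intro x hx
  exact (key x hx).self_of_nhds


/-! ### One complex variable: removable singularities along a finite set; finiteness of zeros -/

section OneVariable

variable [CompleteSpace F]

/-- **Riemann's removable singularity theorem along a finite set.** A function complex-
differentiable on `V ∖ S` (`V ⊆ ℂ` open, `S` finite) and bounded there agrees on `V ∖ S` with a
function complex-differentiable on all of `V` (induction on `S`, one point at a time by
`Complex.differentiableOn_update_limUnder_of_bddAbove`). [folklore] -/
theorem exists_differentiableOn_eqOn_diff_finset {g : ℂ → F} {V : Set ℂ} (hV : IsOpen V)
    (S : Finset ℂ) (hg : DifferentiableOn ℂ g (V \ S))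
    (hb : BddAbove (norm ∘ g '' (V \ S))) :
    ∃ g' : ℂ → F, DifferentiableOn ℂ g' V ∧ EqOn g' g (V \ S) := by
  classical
  induction S using Finset.induction_on generalizing g with
  | empty => exact ⟨g, by simpa using hg, fun _ _ => rfl⟩
  | insert c S hcS ih =>
    -- remove the singularity at `c` (inside the open set `V ∖ S`)
    have hVS : IsOpen (V \ (S : Set ℂ)) := hV.sdiff S.finite_toSet.isClosed
    have hdiff : (V \ (S : Set ℂ)) \ {c} = V \ (insert c S : Finset ℂ) := by
      rw [Finset.coe_insert, sdiff_sdiff, union_comm, ← insert_eq]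
    by_cases hcV : c ∈ V \ (S : Set ℂ)
    · set g₁ : ℂ → F := update g c (limUnder (𝓝[≠] c) g) with hg₁
      have hg₁d : DifferentiableOn ℂ g₁ (V \ (S : Set ℂ)) := by
        refine Complex.differentiableOn_update_limUnder_of_bddAbove (hVS.mem_nhds hcV) ?_ ?_
        · rwa [hdiff]
        · rwa [hdiff]
      have hg₁g : EqOn g₁ g (V \ (insert c S : Finset ℂ)) := by
        intro z hz
        have hzc : z ≠ c := by
          rintro rfl
          exact hz.2 (Finset.mem_insert_self _ _)
        simp [hg₁, update_of_ne hzc]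
      have hb₁ : BddAbove (norm ∘ g₁ '' (V \ (S : Set ℂ))) := by
        obtain ⟨C, hC⟩ := hb
        refine ⟨max C ‖g₁ c‖, ?_⟩
        rintro _ ⟨z, hz, rfl⟩
        by_cases hzc : z = c
        · subst hzc
          exact le_max_right _ _
        · have hz' : z ∈ V \ (insert c S : Finset ℂ) := by
            rw [← hdiff]
            exact ⟨hz, hzc⟩
          calc (norm ∘ g₁) z = ‖g z‖ := by simp [hg₁g hz']
            _ ≤ C := hC (mem_image_of_mem _ hz')
            _ ≤ max C ‖g₁ c‖ := le_max_left _ _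
      obtain ⟨g', hg'd, hg'⟩ := ih hg₁d hb₁
      refine ⟨g', hg'd, fun z hz => ?_⟩
      have hz' : z ∈ V \ (S : Set ℂ) := by
        rw [← hdiff] at hz
        exact hz.1
      rw [hg' hz', hg₁g hz]
    · -- `c ∉ V ∖ S`: nothing to remove
      have heq : V \ (insert c S : Finset ℂ) = V \ (S : Set ℂ) := by
        rw [← hdiff, sdiff_singleton_eq_self hcV]
      rw [heq] at hg hb
      obtain ⟨g', hg'd, hg'⟩ := ih hg hb
      exact ⟨g', hg'd, by rwa [heq]⟩

omit [CompleteSpace F] in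
/-- A function complex-differentiable on an open ball and not vanishing at some point of it has
only finitely many zeros on any compact subset of the ball (isolated zeros and compactness).
[folklore] -/
theorem finite_zeros_of_isCompact {s : ℂ → ℂ} {z₀ : ℂ} {R : ℝ}
    (hs : DifferentiableOn ℂ s (ball z₀ R)) {t₁ : ℂ} (ht₁ : t₁ ∈ ball z₀ R) (hst₁ : s t₁ ≠ 0)
    {K : Set ℂ} (hK : IsCompact K) (hKR : K ⊆ ball z₀ R) :
    {t ∈ K | s t = 0}.Finite := by
  by_contra hinf
  obtain ⟨t₀, ht₀K, hacc⟩ :=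
    Set.Infinite.exists_accPt_of_subset_isCompact hinf hK (sep_subset _ _)
  have han : AnalyticOnNhd ℂ s (ball z₀ R) := hs.analyticOnNhd isOpen_ball
  have hfreq : ∃ᶠ t in 𝓝[≠] t₀, s t = 0 := by
    rw [accPt_iff_frequently] at hacc
    rw [Filter.frequently_iff] at hacc ⊢
    intro W hW
    obtain ⟨W', hW', hW'W⟩ : ∃ W' ∈ 𝓝 t₀, W' ∩ {t₀}ᶜ ⊆ W :=
      mem_nhdsWithin_iff_exists_mem_nhds_inter.1 hW
    obtain ⟨t, htW', htne, ht⟩ := hacc hW'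
    exact ⟨t, hW'W ⟨htW', htne⟩, ht.2⟩
  have hzero := han.eqOn_zero_of_preconnected_of_frequently_eq_zero
    (convex_ball z₀ R).isPreconnected (hKR ht₀K) hfreq
  exact hst₁ (hzero ht₁)

end OneVariable


/-! ### The Riemann extension theorem across thin sets -/

section Extension

variable [CompleteSpace F]

omit [NormedSpace ℂ E] [NormedSpace ℂ F] [CompleteSpace F] in
/-- Local uniform bounds from pointwise local bounds: if `f` is locally bounded off `A` near every
point of a compact set `K`, it is bounded on `K ∖ A`. [folklore] -/
theorem exists_forall_norm_le_of_isCompact {f : E → F} {A K : Set E} (hK : IsCompact K)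
    (h : ∀ x ∈ K, ∃ W ∈ 𝓝 x, ∃ C : ℝ, ∀ y ∈ W \ A, ‖f y‖ ≤ C) :
    ∃ C : ℝ, ∀ y ∈ K \ A, ‖f y‖ ≤ C := by
  classical
  choose! W hW C hC using h
  obtain ⟨T, hTK, hKT⟩ := hK.elim_nhds_subcover W hW
  refine ⟨∑ x ∈ T, |C x|, fun y hy => ?_⟩
  obtain ⟨x, hxT, hyx⟩ : ∃ x ∈ T, y ∈ W x := by simpa using hKT hy.1
  calc ‖f y‖ ≤ C x := hC x (hTK x hxT) y ⟨hyx, hy.2⟩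
    _ ≤ |C x| := le_abs_self _
    _ ≤ ∑ x ∈ T, |C x| := Finset.single_le_sum (f := fun x => |C x|) (fun _ _ => abs_nonneg _) hxT

/-- **Riemann extension theorem, local form.** Let `U` be open in a complex normed space `E`,
`A ⊆ E` with `U ∖ A` open, and suppose `A ∩ U` lies in the zero set of a function `φ`
holomorphic on `U` which does not vanish identically near the point `a ∈ U`. If `f` is holomorphic
on `U ∖ A` and locally bounded near each point of `A ∩ U`, then on some open neighbourhood `V ⊆ U`
of `a` there is a holomorphic `g` with `g = f` on `V ∖ A`. Construction (Chirka A1.4, proof of the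
Theorem, case `n > 1`): choose a direction `v` with `φ (a + v) ≠ 0` and a radius `r` such that
`φ (a + t v) ≠ 0` for `|t| = r`; for `z` near `a` put `g z = (2πi)⁻¹ ∮_{|t|=r} f (z + t v) dt / t`,
holomorphic by differentiation under the integral sign, and equal to `f z` for `z ∉ A` by the
one-variable removable singularity theorem and Cauchy's formula on the disc `{z + t v : |t| ≤ r}`,
which meets `A` in finitely many points.
[Chirka, *Complex Analytic Sets*, A1.4 (proof of the Theorem)] [folklore] -/
theorem exists_nhds_differentiableOn_eqOn_of_thin {f : E → F} {φ : E → ℂ} {U A : Set E}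
    (hU : IsOpen U) (hUA : IsOpen (U \ A)) {a : E} (ha : a ∈ U)
    (hφ : DifferentiableOn ℂ φ U) (hAφ : ∀ x ∈ A ∩ U, φ x = 0) (hφa : ¬ φ =ᶠ[𝓝 a] 0)
    (hf : DifferentiableOn ℂ f (U \ A))
    (hbdd : ∀ x ∈ A ∩ U, ∃ W ∈ 𝓝 x, ∃ C : ℝ, ∀ y ∈ W \ A, ‖f y‖ ≤ C) :
    ∃ V : Set E, IsOpen V ∧ a ∈ V ∧ V ⊆ U ∧
      ∃ g : E → F, DifferentiableOn ℂ g V ∧ EqOn g f (V \ A) := by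
  -- a point `b = a + v` near `a` with `φ b ≠ 0`
  obtain ⟨ρ, hρ, hρU⟩ := Metric.isOpen_iff.1 hU a ha
  have hfr : ∃ᶠ y in 𝓝 a, φ y ≠ 0 := by
    simpa [Filter.EventuallyEq, Filter.not_eventually] using hφa
  obtain ⟨b, hbφ, hb⟩ := (hfr.and_eventually (ball_mem_nhds a (by positivity : (0 : ℝ) < ρ / 3))).exists
  set v : E := b - a with hv_def
  have hv : ‖v‖ < ρ / 3 := by rwa [hv_def, ← dist_eq_norm]
  have hslice : ∀ t ∈ ball (0 : ℂ) 3, a + t • v ∈ U := by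
    intro t ht
    refine hρU ?_
    rw [mem_ball, dist_zero_right] at ht
    rw [mem_ball, dist_eq_norm, add_sub_cancel_left, norm_smul]
    nlinarith [norm_nonneg t, norm_nonneg v]
  -- the slice `s₀ t = φ (a + t v)` has an isolated zero at `t = 0`
  set s₀ : ℂ → ℂ := fun t => φ (a + t • v) with hs₀_def
  have hs₀ : DifferentiableOn ℂ s₀ (ball 0 3) :=
    (differentiableOn_slice hφ a v).mono fun t ht => hslice t ht
  have h13 : (1 : ℂ) ∈ ball (0 : ℂ) 3 := by simp
  have hs₀1 : s₀ 1 ≠ 0 := by simpa [hs₀_def, hv_def] using hbφ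
  have han : AnalyticOnNhd ℂ s₀ (ball 0 3) := hs₀.analyticOnNhd isOpen_ball
  have h03 : (0 : ℂ) ∈ ball (0 : ℂ) 3 := mem_ball_self (by norm_num)
  obtain ⟨r, hr, hr1, hsph⟩ : ∃ r : ℝ, 0 < r ∧ r ≤ 1 ∧ ∀ t ∈ sphere (0 : ℂ) r, s₀ t ≠ 0 := by
    rcases (han 0 h03).eventually_eq_zero_or_eventually_ne_zero with hz | hnz
    · exact absurd (han.eqOn_zero_of_preconnected_of_eventuallyEq_zero
        (convex_ball 0 3).isPreconnected h03 hz h13) hs₀1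
    · obtain ⟨ε, hε, hεs⟩ := Metric.eventually_nhds_iff.1 (eventually_nhdsWithin_iff.1 hnz)
      refine ⟨min (ε / 2) 1, by positivity, min_le_right _ _, fun t ht => ?_⟩
      have htn : ‖t‖ = min (ε / 2) 1 := by simpa using ht
      refine hεs (y := t) ?_ ?_
      · rw [dist_zero_right, htn]
        exact lt_of_le_of_lt (min_le_left _ _) (half_lt_self hε)
      · rw [mem_compl_singleton_iff, ← norm_pos_iff, htn]
        positivity
  -- tube lemma: uniformly for `z` near `a`, the disc `{z + t v : |t| ≤ 2}` lies in `U` and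
  -- `φ ≠ 0` on the circle `{z + t v : |t| = r}`
  have hΨc : Continuous fun q : E × ℂ => q.1 + q.2 • v :=
    continuous_fst.add (continuous_snd.smul continuous_const)
  obtain ⟨V₁, W₁, hV₁o, -, haV₁, hW₁, hVW₁⟩ :
      ∃ V₁ W₁ : Set _, IsOpen V₁ ∧ IsOpen W₁ ∧ {a} ⊆ V₁ ∧ closedBall (0 : ℂ) 2 ⊆ W₁ ∧
        V₁ ×ˢ W₁ ⊆ (fun q : E × ℂ => q.1 + q.2 • v) ⁻¹' U := by
    refine generalized_tube_lemma isCompact_singleton (isCompact_closedBall 0 2)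
      (hU.preimage hΨc) ?_
    rintro ⟨x, t⟩ ⟨hx, ht⟩
    rw [mem_singleton_iff] at hx
    subst hx
    refine hslice t ?_
    rw [mem_closedBall, dist_zero_right] at ht
    rw [mem_ball, dist_zero_right]
    linarith
  have hNo : IsOpen ((fun q : E × ℂ => q.1 + q.2 • v) ⁻¹' (U ∩ φ ⁻¹' {0}ᶜ)) :=
    (hφ.continuousOn.isOpen_inter_preimage hU isOpen_compl_singleton).preimage hΨc
  obtain ⟨V₂, W₂, hV₂o, -, haV₂, hW₂, hVW₂⟩ :
      ∃ V₂ W₂ : Set _, IsOpen V₂ ∧ IsOpen W₂ ∧ {a} ⊆ V₂ ∧ sphere (0 : ℂ) r ⊆ W₂ ∧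
        V₂ ×ˢ W₂ ⊆ (fun q : E × ℂ => q.1 + q.2 • v) ⁻¹' (U ∩ φ ⁻¹' {0}ᶜ) := by
    refine generalized_tube_lemma isCompact_singleton (isCompact_sphere 0 r) hNo ?_
    rintro ⟨x, t⟩ ⟨hx, ht⟩
    rw [mem_singleton_iff] at hx
    subst hx
    refine ⟨hslice t ?_, hsph t ht⟩
    have htn : ‖t‖ = r := by simpa using ht
    rw [mem_ball, dist_zero_right, htn]
    linarith
  set V := V₁ ∩ V₂ with hV_def
  have hVU : ∀ z ∈ V, ∀ t ∈ closedBall (0 : ℂ) 2, z + t • v ∈ U :=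
    fun z hz t ht => hVW₁ (mk_mem_prod hz.1 (hW₁ ht))
  have hVφ : ∀ z ∈ V, ∀ t ∈ sphere (0 : ℂ) r, z + t • v ∈ U ∧ φ (z + t • v) ≠ 0 :=
    fun z hz t ht => hVW₂ (mk_mem_prod hz.2 (hW₂ ht))
  have hVA : ∀ z ∈ V, ∀ t ∈ sphere (0 : ℂ) r, z + t • v ∈ U \ A := fun z hz t ht =>
    ⟨(hVφ z hz t ht).1, fun hA => (hVφ z hz t ht).2 (hAφ _ ⟨hA, (hVφ z hz t ht).1⟩)⟩
  have hVsub : V ⊆ U := fun z hz => by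
    simpa using hVU z hz 0 (mem_closedBall_self (by norm_num))
  have haV : a ∈ V := ⟨haV₁ (mem_singleton a), haV₂ (mem_singleton a)⟩
  -- the extension `g z = (2πi)⁻¹ ∮_{|t| = r} t⁻¹ f (z + t v) dt`
  set g : E → F := fun z => (2 * π * I)⁻¹ • ∮ t in C(0, r), t⁻¹ • f (z + t • v) with hg_def
  refine ⟨V, hV₁o.inter hV₂o, haV, hVsub, g, ?_, ?_⟩
  · -- holomorphy: differentiation under the integral sign
    have hcm : ∀ θ : ℝ, circleMap 0 r θ ≠ 0 := fun θ => circleMap_ne_center hr.ne'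
    have hc : Continuous fun θ : ℝ => deriv (circleMap 0 r) θ * (circleMap 0 r θ)⁻¹ := by
      simp only [deriv_circleMap]
      exact ((continuous_circleMap 0 r).mul continuous_const).mul
        ((continuous_circleMap 0 r).inv₀ hcm)
    have hp : Continuous fun θ : ℝ => circleMap 0 r θ • v :=
      (continuous_circleMap 0 r).smul continuous_const
    have hg_eq : g = fun z => (2 * π * I)⁻¹ • ∫ θ in (0 : ℝ)..2 * π,
        (deriv (circleMap 0 r) θ * (circleMap 0 r θ)⁻¹) •
          f (ContinuousLinearMap.id ℂ E z + circleMap 0 r θ • v) := by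
      funext z
      simp only [hg_def, circleIntegral, ContinuousLinearMap.id_apply, smul_smul]
    rw [hg_eq]
    intro z hz
    refine (DifferentiableAt.const_smul ?_ _).differentiableWithinAt
    refine differentiableAt_intervalIntegral_affine hf hUA (ContinuousLinearMap.id ℂ E) hp hc
      fun θ _ => ?_
    exact hVA z hz _ (circleMap_mem_sphere 0 hr.le θ)
  · -- `g = f` off `A`: removable singularities and Cauchy's formula on the slice through `z`
    rintro z ⟨hzV, hzA⟩
    set sz : ℂ → F := fun t => f (z + t • v) with hsz_def
    have hrmem : ((r : ℝ) : ℂ) ∈ sphere (0 : ℂ) r := by simp [hr.le]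
    -- the disc `{z + t v : |t| ≤ 3/2}` meets `A` in a finite set `S`
    have hSfin : {t ∈ closedBall (0 : ℂ) (3 / 2) | z + t • v ∈ A}.Finite := by
      have hφz : DifferentiableOn ℂ (fun t : ℂ => φ (z + t • v)) (ball 0 2) :=
        (differentiableOn_slice hφ z v).mono fun t ht => hVU z hzV t (ball_subset_closedBall ht)
      have hr2 : ((r : ℝ) : ℂ) ∈ ball (0 : ℂ) 2 := by
        rw [mem_ball, dist_zero_right, Complex.norm_real, Real.norm_eq_abs, abs_of_pos hr]
        linarith
      have hfin := finite_zeros_of_isCompact hφz hr2 (hVφ z hzV _ hrmem).2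
        (isCompact_closedBall (0 : ℂ) (3 / 2)) (closedBall_subset_ball (by norm_num))
      refine hfin.subset fun t ht => ⟨ht.1, hAφ _ ⟨ht.2, hVU z hzV t ?_⟩⟩
      exact closedBall_subset_closedBall (by norm_num) ht.1
    set S : Finset ℂ := hSfin.toFinset with hS_def
    have hSmem : ∀ t, t ∈ (S : Set ℂ) ↔ t ∈ closedBall (0 : ℂ) (3 / 2) ∧ z + t • v ∈ A := by
      intro t
      rw [hS_def, Finset.mem_coe, Set.Finite.mem_toFinset]
      rfl
    have hD : ∀ t ∈ ball (0 : ℂ) (3 / 2) \ (S : Set ℂ), z + t • v ∈ U \ A := by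
      rintro t ⟨htD, htS⟩
      have htU : z + t • v ∈ U :=
        hVU z hzV t (closedBall_subset_closedBall (by norm_num) (ball_subset_closedBall htD))
      exact ⟨htU, fun hA => htS ((hSmem t).2 ⟨ball_subset_closedBall htD, hA⟩)⟩
    -- the slice `sz` is holomorphic off `S` and bounded near the disc
    have hszd : DifferentiableOn ℂ sz (ball (0 : ℂ) (3 / 2) \ (S : Set ℂ)) := by
      intro t ht
      have hft : DifferentiableAt ℂ f (z + t • v) :=
        hf.differentiableAt (hUA.mem_nhds (hD t ht))
      exact (hft.comp t ((differentiableAt_const z).add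
        (differentiableAt_id.smul_const v))).differentiableWithinAt
    have hloc : ∀ x ∈ (fun t : ℂ => z + t • v) '' closedBall (0 : ℂ) (3 / 2),
        ∃ W ∈ 𝓝 x, ∃ C : ℝ, ∀ y ∈ W \ A, ‖f y‖ ≤ C := by
      rintro x ⟨t, ht, rfl⟩
      have hxU : z + t • v ∈ U := hVU z hzV t (closedBall_subset_closedBall (by norm_num) ht)
      by_cases hxA : z + t • v ∈ A
      · exact hbdd _ ⟨hxA, hxU⟩
      · have hcont : ContinuousAt f (z + t • v) :=
          (hf.differentiableAt (hUA.mem_nhds ⟨hxU, hxA⟩)).continuousAt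
        exact ⟨_, hcont.norm.eventually (gt_mem_nhds (lt_add_one ‖f (z + t • v)‖)),
          ‖f (z + t • v)‖ + 1, fun y hy => le_of_lt hy.1⟩
    have hbd : BddAbove (norm ∘ sz '' (ball (0 : ℂ) (3 / 2) \ (S : Set ℂ))) := by
      have hKc : IsCompact ((fun t : ℂ => z + t • v) '' closedBall (0 : ℂ) (3 / 2)) :=
        (isCompact_closedBall _ _).image (by fun_prop)
      obtain ⟨C, hC⟩ := exists_forall_norm_le_of_isCompact hKc hloc
      refine ⟨C, ?_⟩
      rintro _ ⟨t, ht, rfl⟩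
      exact hC _ ⟨mem_image_of_mem _ (ball_subset_closedBall ht.1), (hD t ht).2⟩
    -- extension across `S`, then Cauchy's formula at `t = 0`
    obtain ⟨s', hs'd, hs'⟩ := exists_differentiableOn_eqOn_diff_finset isOpen_ball S hszd hbd
    have hcl : closedBall (0 : ℂ) r ⊆ ball (0 : ℂ) (3 / 2) := closedBall_subset_ball (by linarith)
    have hdc : DiffContOnCl ℂ s' (ball (0 : ℂ) r) := by
      refine (hs'd.mono ?_).diffContOnCl
      rw [closure_ball (0 : ℂ) hr.ne']
      exact hcl
    have hcauchy := hdc.two_pi_i_inv_smul_circleIntegral_sub_inv_smul (mem_ball_self hr)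
    have h0 : s' 0 = f z := by
      have h0mem : (0 : ℂ) ∈ ball (0 : ℂ) (3 / 2) \ (S : Set ℂ) := by
        refine ⟨mem_ball_self (by norm_num), fun h => hzA ?_⟩
        simpa using ((hSmem 0).1 h).2
      rw [hs' h0mem]
      simp [hsz_def]
    have hint : (∮ t in C(0, r), (t - 0)⁻¹ • s' t) = ∮ t in C(0, r), t⁻¹ • f (z + t • v) := by
      refine circleIntegral.integral_congr hr.le fun t ht => ?_
      have htmem : t ∈ ball (0 : ℂ) (3 / 2) \ (S : Set ℂ) :=
        ⟨hcl (sphere_subset_closedBall ht), fun h => (hVA z hzV t ht).2 ((hSmem t).1 h).2⟩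
      simp only [sub_zero, hs' htmem, hsz_def]
    change (2 * π * I)⁻¹ • (∮ t in C(0, r), t⁻¹ • f (z + t • v)) = f z
    rw [← hint, hcauchy, h0]

omit [CompleteSpace F] in
/-- **Thin sets are nowhere dense**: if near each point of `A ∩ U` the set `A` lies in the zero
set of a holomorphic function not vanishing identically near that point, then `U ∖ A` is dense in
`U`. [Chirka, *Complex Analytic Sets*, §2.2] [folklore] -/
theorem subset_closure_diff_of_thin {U A : Set E} (hU : IsOpen U)
    (hthin : ∀ a ∈ A ∩ U, ∃ (φ : E → ℂ) (W : Set E), IsOpen W ∧ a ∈ W ∧ W ⊆ U ∧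
      DifferentiableOn ℂ φ W ∧ (∀ x ∈ A ∩ W, φ x = 0) ∧ ¬ φ =ᶠ[𝓝 a] 0) :
    U ⊆ closure (U \ A) := by
  intro x hx
  by_cases hxA : x ∈ A
  · obtain ⟨φ, W, hWo, hxW, -, -, hAφ, hφx⟩ := hthin x ⟨hxA, hx⟩
    rw [mem_closure_iff_nhds]
    intro T hT
    by_contra hcon
    rw [not_nonempty_iff_eq_empty] at hcon
    apply hφx
    filter_upwards [hT, hWo.mem_nhds hxW, hU.mem_nhds hx] with y hyT hyW hyU
    have hyA : y ∈ A := by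
      by_contra hyA
      have : y ∈ T ∩ (U \ A) := ⟨hyT, hyU, hyA⟩
      rw [hcon] at this
      exact this
    exact hAφ y ⟨hyA, hyW⟩
  · exact subset_closure ⟨hx, hxA⟩

omit [NormedSpace ℂ F] [CompleteSpace F] in
/-- **Uniqueness of holomorphic (indeed continuous) extensions across thin sets**: two functions
continuous on `U` which agree on `U ∖ A`, `A` thin, agree on `U`. [folklore] -/
theorem eqOn_of_eqOn_diff_of_thin {g₁ g₂ : E → F} {U A : Set E} (hU : IsOpen U)
    (hthin : ∀ a ∈ A ∩ U, ∃ (φ : E → ℂ) (W : Set E), IsOpen W ∧ a ∈ W ∧ W ⊆ U ∧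
      DifferentiableOn ℂ φ W ∧ (∀ x ∈ A ∩ W, φ x = 0) ∧ ¬ φ =ᶠ[𝓝 a] 0)
    (h₁ : ContinuousOn g₁ U) (h₂ : ContinuousOn g₂ U) (h : EqOn g₁ g₂ (U \ A)) : EqOn g₁ g₂ U :=
  h.of_subset_closure h₁ h₂ sdiff_subset (subset_closure_diff_of_thin hU hthin)

/-- **Riemann extension theorem** (first Riemann removable singularity theorem, several complex
variables; `E` any complex normed space, values in a complete space). Let `U ⊆ E` and let
`A ⊆ E` be *thin in `U`*: `U ∖ A` is open, and every point `a ∈ A ∩ U` has an open neighbourhood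
`W ⊆ U` and a holomorphic `φ : W → ℂ` vanishing on `A ∩ W` but not identically near `a` (so `U`
is open). Then
every `f` holomorphic on `U ∖ A` and locally bounded near each point of `A ∩ U` extends to a
holomorphic function on `U`, i.e. there is `g` holomorphic on `U` with `g = f` on `U ∖ A`; the
extension is unique (`eqOn_of_eqOn_diff_of_thin`). The local extensions
(`exists_nhds_differentiableOn_eqOn_of_thin`) patch together because `U ∖ A` is dense in `U`
(`subset_closure_diff_of_thin`).
[Chirka, *Complex Analytic Sets*, A1.4 Theorem (there for closed `E` with `H_{2n-1}(E) = 0`; the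
thin-set version is the classical first Riemann removable singularity theorem)] [folklore] -/
theorem exists_differentiableOn_eqOn_of_thin {f : E → F} {U A : Set E}
    (hUA : IsOpen (U \ A))
    (hthin : ∀ a ∈ A ∩ U, ∃ (φ : E → ℂ) (W : Set E), IsOpen W ∧ a ∈ W ∧ W ⊆ U ∧
      DifferentiableOn ℂ φ W ∧ (∀ x ∈ A ∩ W, φ x = 0) ∧ ¬ φ =ᶠ[𝓝 a] 0)
    (hf : DifferentiableOn ℂ f (U \ A))
    (hbdd : ∀ x ∈ A ∩ U, ∃ W ∈ 𝓝 x, ∃ C : ℝ, ∀ y ∈ W \ A, ‖f y‖ ≤ C) :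
    ∃ g : E → F, DifferentiableOn ℂ g U ∧ EqOn g f (U \ A) := by
  classical
  -- local extensions at every point of `U`
  have hloc : ∀ a ∈ U, ∃ V : Set E, IsOpen V ∧ a ∈ V ∧ V ⊆ U ∧
      ∃ g : E → F, DifferentiableOn ℂ g V ∧ EqOn g f (V \ A) := by
    intro a ha
    by_cases haA : a ∈ A
    · obtain ⟨φ, W, hWo, haW, hWU, hφ, hAφ, hφa⟩ := hthin a ⟨haA, ha⟩
      have hWA : IsOpen (W \ A) := by
        have : W \ A = W ∩ (U \ A) := by
          ext y
          exact ⟨fun hy => ⟨hy.1, hWU hy.1, hy.2⟩, fun hy => ⟨hy.1, hy.2.2⟩⟩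
        rw [this]
        exact hWo.inter hUA
      obtain ⟨V, hVo, haV, hVW, g, hg, hgf⟩ :=
        exists_nhds_differentiableOn_eqOn_of_thin hWo hWA haW hφ hAφ hφa
          (hf.mono fun y hy => ⟨hWU hy.1, hy.2⟩)
          fun x hx => hbdd x ⟨hx.1, hWU hx.2⟩
      exact ⟨V, hVo, haV, hVW.trans hWU, g, hg, hgf⟩
    · exact ⟨U \ A, hUA, ⟨ha, haA⟩, sdiff_subset, f, hf, fun _ _ => rfl⟩
  choose V hVo haV hVU g hg hgf using hloc
  -- two local extensions agree on the overlap of their domains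
  have hagree : ∀ (a : E) (ha : a ∈ U) (b : E) (hb : b ∈ U),
      EqOn (g a ha) (g b hb) (V a ha ∩ V b hb) := by
    intro a ha b hb
    have hO : IsOpen (V a ha ∩ V b hb) := (hVo a ha).inter (hVo b hb)
    refine eqOn_of_eqOn_diff_of_thin (A := A) hO ?_ ((hg a ha).continuousOn.mono inter_subset_left)
      ((hg b hb).continuousOn.mono inter_subset_right) fun y hy => ?_
    · intro x hx
      obtain ⟨φ, W, hWo, hxW, hWU, hφ, hAφ, hφx⟩ := hthin x ⟨hx.1, hVU a ha hx.2.1⟩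
      refine ⟨φ, W ∩ (V a ha ∩ V b hb), hWo.inter hO, ⟨hxW, hx.2⟩, inter_subset_right,
        hφ.mono inter_subset_left, fun y hy => hAφ y ⟨hy.1, hy.2.1⟩, hφx⟩
    · rw [hgf a ha ⟨hy.1.1, hy.2⟩, hgf b hb ⟨hy.1.2, hy.2⟩]
  -- glue
  refine ⟨fun x => if hx : x ∈ U then g x hx x else 0, fun a ha => ?_, fun x hx => ?_⟩
  · have hev : (fun x => if hx : x ∈ U then g x hx x else 0) =ᶠ[𝓝 a] g a ha := by
      filter_upwards [(hVo a ha).mem_nhds (haV a ha)] with x hx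
      have hxU : x ∈ U := hVU a ha hx
      rw [dif_pos hxU]
      exact hagree x hxU a ha ⟨haV x hxU, hx⟩
    exact (((hg a ha).differentiableAt ((hVo a ha).mem_nhds (haV a ha))).congr_of_eventuallyEq
      hev).differentiableWithinAt
  · simp only [dif_pos hx.1]
    exact hgf x hx.1 ⟨haV x hx.1, hx.2⟩

end Extension
end SCV
end Literature.Analysis.Complex
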